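import Mathlib.RingTheory.MvPolynomial.Basic
import Mathlib.Algebra.MvPolynomial.Funext
import Mathlib.Algebra.MvPolynomial.Monad
import HarnessLib

/-!
# The shifted succinct Shpilka–Volkovich generator and succinct hitting sets for sparse polynomials (Forbes–Shpilka–Volk 2018)

Topic `Computability/AlgebraicComplexity` (polynomial identity testing; cite item `wi-17630` of
route MatrixMultiplication/SuccinctSecantEquations, barrier material "succinct equations").

Forbes–Shpilka–Volk, *Succinct hitting sets and barriers to proving lower bounds for algebraic
circuits*, Theory Comput. 14 (2018) / STOC 2017 = arXiv:1701.05328, numbered below as in the arXiv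
text. The FRAMEWORK half of that paper — Def. 1 (algebraically natural proof), Def. 3 (succinct
hitting set), Thm. 4 (natural proofs against `𝒞` from `𝒟` exist iff the coefficient vectors of `𝒞`
are NOT a hitting set for `𝒟`, proved) and the conditional barrier of Cor. 5 / Question 6 — is
already in the tree: `Literature/Barriers/ValiantsHypothesis/AlgebraicNaturalProofs.lean`
(`coeffVector`, `IsNaturalProof`, `IsSuccinctHittingSet`, `exists_isNaturalProof_iff`,
`SuccinctHittingSetsForVP`, `AlgebraicNaturalProofs`). This file vendors the simplest of the
paper's UNCONDITIONAL succinct hitting sets (Thm. 9, bullet "sparse polynomials"; §5.1), with the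
explicit generator it rests on:

* `svGenCoeff n k m` — the **shifted succinct SV generator** `G^{SV'}_{n,k}` of Constructions 25
  and 29 as a polynomial map: its coordinate at the multilinear monomial `x^m = x_S`
  (`S = supp m ⊆ [n]`, `N = 2ⁿ` coordinates) is the polynomial
  `∑_{j < k} y_j ∏_{i ∈ S} z_{j,i} ∏_{i ∉ S} (1 - z_{j,i}) + 1` in the seed variables
  `y_j` (`Sum.inl j`) and `z_{j,i}` (`Sum.inr (j, i)`), i.e. the `x_S`-coefficient of
  `Q^{SV'}_{n,k} = ∑_j y_j ∏_i (z_{j,i} x_i + 1 - z_{j,i}) + ∏_i (x_i + 1)`;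
* `svPoly n k α β` — the value of `Q^{SV'}_{n,k}` at a seed `(α, β)`, an explicit multilinear
  polynomial in `x_1, …, x_n` given as a sum of `k + 1` products of `n` affine univariate forms (a
  multilinear depth-3 `ΣΠΣ` formula of top fan-in `k + 1` and size `O(kn)`: the "succinctness",
  Fact 26 / Fact 30), with the PROVED identity `coeff_svPoly_eq_eval_svGenCoeff` (its coefficient
  vector is the generator's output at the seed) and its multilinearity;
* NAMED FACT `ForbesShpilkaVolk2018_svGeneratorHitsSparse` — **Cor. 34 (generator form, any
  field)**: for every nonzero `D ∈ 𝔽[c_m : m multilinear]` with at most `2^k` monomials,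
  `D ∘ G^{SV'}_{n,k} ≠ 0` as a polynomial in the seed variables (printed: "`G^{SV'}_{n, log s}` … is
  a `poly(log s, n)`-`ΣΠΣ` succinct generator for the class of `s`-sparse polynomials"; proof in
  print: after the shift by `𝟙` a nonzero `s`-sparse polynomial has a monomial of support
  `≤ log s`, Lemma 32 via Oliveira's Lemma 33, and the SV generator plants free seed variables on
  any `≤ k` coordinates, Lemma 28 / Lemma 31 — not formalised here);
* PROVED consequence over an infinite field (print: "over large enough fields" generators give
  hitting sets, remark after Def. 7): some seed `(α, β)` makes `D` non-vanish at the coefficient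
  vector of `svPoly n k α β` (`….exists_svPoly`) — the succinct hitting set statement of Thm. 9
  for sparse polynomials, in the shape `eval (coeff · f) D ≠ 0` of `IsSuccinctHittingSet`.

Not here: the other classes of Thm. 9 (`Σ^{O(1)}ΠΣ`, bounded transcendence degree, `ΣmΛΣΠ^{O(1)}`,
commutative roABPs, depth-`O(1)` occur-`O(1)`), Thm. 10 (width-`w²` roABPs hit width-`w` roABPs)
and the universal-circuit results Thm. 13 / Cor. 15 — each needs its own circuit-class vocabulary.

## References

* M. A. Forbes, A. Shpilka, B. L. Volk, *Succinct hitting sets and barriers to proving lower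
  bounds for algebraic circuits*, Theory Comput. 14 (2018) 18:1–45 (STOC 2017), arXiv:1701.05328:
  Def. 7, Thm. 9, Constructions 25 and 29, Facts 26–27 and 30, Lemmas 28, 31–33, Cor. 34.
  [ForbesShpilkaVolk2018]
-/

noncomputable section

namespace Literature.Computability.AlgebraicComplexity

open MvPolynomial Finset

/-! ## Multilinear monomials and the exponent vector of a subset -/

section Monomials

variable {n : ℕ}

/-- The multilinear exponent vectors in `n` variables (every exponent `≤ 1`): the `N = 2ⁿ`
coordinates `c_m` of the space of multilinear polynomials. [cite: ForbesShpilkaVolk2018, §1.5 (the space of multilinear polynomials)] -/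
def multilinearMonomials (n : ℕ) : Set (Fin n →₀ ℕ) :=
  {m | ∀ i, m i ≤ 1}

/-- Membership in `multilinearMonomials n` is decidable (finitely many exponents to inspect).
[folklore] -/
instance multilinearMonomials.decidableMem (n : ℕ) : DecidablePred (· ∈ multilinearMonomials n) :=
  fun m => inferInstanceAs (Decidable (∀ i, m i ≤ 1))

/-- The exponent vector `𝟙_T` of the multilinear monomial `x_T = ∏_{i ∈ T} x_i`. [folklore] -/
def subsetExp (T : Finset (Fin n)) : Fin n →₀ ℕ :=
  ∑ i ∈ T, Finsupp.single i 1

/-- `𝟙_T(i) = [i ∈ T]`. [folklore] -/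
theorem subsetExp_apply (T : Finset (Fin n)) (i : Fin n) :
    subsetExp T i = if i ∈ T then 1 else 0 := by
  rw [subsetExp, Finsupp.finsetSum_apply]
  simp_rw [Finsupp.single_apply]
  rw [Finset.sum_ite_eq']

/-- `𝟙_T` is multilinear. [folklore] -/
theorem subsetExp_mem (T : Finset (Fin n)) : subsetExp T ∈ multilinearMonomials n := by
  intro i
  rw [subsetExp_apply]
  split_ifs <;> simp

/-- `supp 𝟙_T = T`. [folklore] -/
theorem support_subsetExp (T : Finset (Fin n)) : (subsetExp T).support = T := by
  ext i
  rw [Finsupp.mem_support_iff, subsetExp_apply]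
  split_ifs with h <;> simp [h]

/-- A multilinear exponent vector is `𝟙` of its support. [folklore] -/
theorem subsetExp_support {m : Fin n →₀ ℕ} (hm : m ∈ multilinearMonomials n) :
    subsetExp m.support = m := by
  ext i
  rw [subsetExp_apply]
  by_cases h : i ∈ m.support
  · rw [if_pos h]
    have h1 := hm i
    have h2 := Finsupp.mem_support_iff.1 h
    omega
  · rw [if_neg h]
    exact (Finsupp.notMem_support_iff.1 h).symm

/-- `T ↦ 𝟙_T` is injective. [folklore] -/
theorem subsetExp_injective : Function.Injective (subsetExp (n := n)) := fun T T' h => by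
  rw [← support_subsetExp T, h, support_subsetExp]

/-- The monomial `x_T = ∏_{i ∈ T} x_i` is `monomial 𝟙_T 1`. [folklore] -/
theorem prod_X_eq_monomial_subsetExp {R : Type*} [CommSemiring R] (T : Finset (Fin n)) :
    ∏ i ∈ T, (X i : MvPolynomial (Fin n) R) = monomial (subsetExp T) 1 := by
  rw [subsetExp, monomial_sum_one]
  rfl

end Monomials

/-! ## Products of affine univariate forms: the multilinear expansion -/

section Expansion

variable {R : Type*} [CommRing R] {n : ℕ}

/-- `∏_i (a_i x_i + b_i) = ∑_{T ⊆ [n]} (∏_{i ∈ T} a_i ∏_{i ∉ T} b_i) · x_T`. [folklore] -/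
theorem prod_C_mul_X_add_C (a b : Fin n → R) :
    ∏ i : Fin n, (C (a i) * X i + C (b i)) =
      ∑ T : Finset (Fin n), C ((∏ i ∈ T, a i) * ∏ i ∈ Tᶜ, b i) *
        (monomial (subsetExp T) 1 : MvPolynomial (Fin n) R) := by
  rw [Finset.prod_add, Finset.powerset_univ]
  refine Finset.sum_congr rfl fun T _ => ?_
  rw [Finset.prod_mul_distrib, map_mul, map_prod, map_prod, prod_X_eq_monomial_subsetExp, Finset.compl_eq_univ_sdiff]
  ring

/-- Coefficients of `∏_i (a_i x_i + b_i)`: at a multilinear `m` it is `∏_{i ∈ supp m} a_i ∏_{i ∉ supp m} b_i`,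
and `0` at a non-multilinear `m`. [folklore] -/
theorem coeff_prod_C_mul_X_add_C (a b : Fin n → R) (m : Fin n →₀ ℕ) :
    coeff m (∏ i : Fin n, (C (a i) * X i + C (b i))) =
      if m ∈ multilinearMonomials n then (∏ i ∈ m.support, a i) * ∏ i ∈ m.supportᶜ, b i else 0 := by
  classical
  rw [prod_C_mul_X_add_C, coeff_sum]
  simp_rw [coeff_C_mul, coeff_monomial, mul_ite, mul_one, mul_zero]
  split_ifs with hm
  · rw [Finset.sum_eq_single m.support]
    · rw [if_pos (subsetExp_support hm)]
    · intro T _ hT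
      rw [if_neg]
      intro h
      exact hT (by rw [← h, support_subsetExp])
    · exact fun h => (h (mem_univ _)).elim
  · refine Finset.sum_eq_zero fun T _ => ?_
    rw [if_neg]
    intro h
    exact hm (h ▸ subsetExp_mem T)

end Expansion

/-! ## The shifted succinct SV generator (FSV Constructions 25, 29) -/

section Generator

variable (F : Type*) [CommRing F]

/-- **The shifted succinct Shpilka–Volkovich generator `G^{SV'}_{n,k}` as a polynomial map**
(FSV Construction 25: `P(z, x) = ∏_i (z_i x_i + (1 - z_i))`, `Q^{SV}_{n,k} = ∑_{j<k} y_j P(z_j, x)`,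
`G^{SV}_{n,k} = coeff_x(Q^{SV}_{n,k})`; Construction 29: `Q^{SV'} = Q^{SV} + ∏_i (x_i + 1)`,
`G^{SV'} = G^{SV} + 𝟙`): its coordinate at the exponent vector `m` (meant multilinear, `S = supp m`)
is `∑_j y_j ∏_{i : m_i ≠ 0} z_{j,i} ∏_{i : m_i = 0} (1 - z_{j,i}) + 1`, a polynomial in the seed
variables `y_j = Sum.inl j`, `z_{j,i} = Sum.inr (j, i)`. [cite: ForbesShpilkaVolk2018, Constructions 25 and 29] -/
def svGenCoeff (n k : ℕ) (m : Fin n →₀ ℕ) : MvPolynomial (Fin k ⊕ (Fin k × Fin n)) F :=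
  (∑ j : Fin k, X (Sum.inl j) *
      ∏ i : Fin n, (if m i = 0 then 1 - X (Sum.inr (j, i)) else X (Sum.inr (j, i)))) + 1

/-- **The polynomial `Q^{SV'}_{n,k}(α, β, x)` at a seed** `(α, β) ∈ 𝔽^k × (𝔽ⁿ)^k`:
`∑_{j<k} α_j ∏_i (β_{j,i} x_i + (1 - β_{j,i})) + ∏_i (x_i + 1)` — an explicit sum of `k + 1` products
of `n` affine univariate forms (a multilinear `ΣΠΣ` formula of top fan-in `k + 1`; FSV Fact 26 /
Fact 30: "computed by a multilinear `ΣΠΣ` circuit of size `poly(n, k)`"). Its coefficient vectors, over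
all seeds, form the succinct hitting set. [cite: ForbesShpilkaVolk2018, Constructions 25 and 29] -/
def svPoly (n k : ℕ) (α : Fin k → F) (β : Fin k → Fin n → F) : MvPolynomial (Fin n) F :=
  (∑ j : Fin k, C (α j) * ∏ i : Fin n, (C (β j i) * X i + C (1 - β j i))) +
    ∏ i : Fin n, (X i + 1)

variable {F}

/-- The coefficients of `Q^{SV'}_{n,k}(α, β, x)`: at a multilinear `m` with `S = supp m`,
`∑_j α_j ∏_{i ∈ S} β_{j,i} ∏_{i ∉ S} (1 - β_{j,i}) + 1`; zero at non-multilinear `m` (the polynomial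
is multilinear). [cite: ForbesShpilkaVolk2018, Construction 25 (and Lemma 28)] -/
theorem coeff_svPoly (n k : ℕ) (α : Fin k → F) (β : Fin k → Fin n → F) (m : Fin n →₀ ℕ) :
    coeff m (svPoly F n k α β) =
      if m ∈ multilinearMonomials n then
        (∑ j : Fin k, α j * ((∏ i ∈ m.support, β j i) * ∏ i ∈ m.supportᶜ, (1 - β j i))) + 1
      else 0 := by
  have h1 : ∏ i : Fin n, ((X i : MvPolynomial (Fin n) F) + 1) =
      ∏ i : Fin n, (C (1 : F) * X i + C (1 : F)) := by
    simp
  rw [svPoly, coeff_add, coeff_sum, h1, coeff_prod_C_mul_X_add_C]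
  simp_rw [coeff_C_mul, coeff_prod_C_mul_X_add_C]
  split_ifs with hm
  · simp
  · simp

/-- `Q^{SV'}_{n,k}(α, β, x)` is multilinear. [cite: ForbesShpilkaVolk2018, Fact 26] -/
theorem coeff_svPoly_eq_zero {n k : ℕ} (α : Fin k → F) (β : Fin k → Fin n → F) {m : Fin n →₀ ℕ}
    (hm : m ∉ multilinearMonomials n) : coeff m (svPoly F n k α β) = 0 := by
  rw [coeff_svPoly, if_neg hm]

/-- The generator's output at a seed: evaluating the coordinate polynomial `svGenCoeff n k m` at
`(α, β)` gives `∑_j α_j ∏_{i ∈ supp m} β_{j,i} ∏_{i ∉ supp m} (1 - β_{j,i}) + 1`. [cite: ForbesShpilkaVolk2018, Constructions 25 and 29] -/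
theorem eval_svGenCoeff (n k : ℕ) (α : Fin k → F) (β : Fin k → Fin n → F) (m : Fin n →₀ ℕ) :
    eval (Sum.elim α fun p : Fin k × Fin n => β p.1 p.2) (svGenCoeff F n k m) =
      (∑ j : Fin k, α j * ((∏ i ∈ m.support, β j i) * ∏ i ∈ m.supportᶜ, (1 - β j i))) + 1 := by
  have hprod : ∀ j : Fin k, eval (Sum.elim α fun p : Fin k × Fin n => β p.1 p.2)
      (∏ i : Fin n, (if m i = 0 then 1 - X (Sum.inr (j, i)) else X (Sum.inr (j, i)))) =
      (∏ i ∈ m.support, β j i) * ∏ i ∈ m.supportᶜ, (1 - β j i) := by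
    intro j
    rw [map_prod]
    have h1 : ∀ i : Fin n, eval (Sum.elim α fun p : Fin k × Fin n => β p.1 p.2)
        (if m i = 0 then 1 - X (Sum.inr (j, i)) else X (Sum.inr (j, i))) =
        if m i = 0 then 1 - β j i else β j i := by
      intro i
      split_ifs <;> simp
    simp_rw [h1]
    rw [Finset.prod_ite]
    have hs : (univ.filter fun i : Fin n => m i = 0) = m.supportᶜ := by
      ext i; simp [Finsupp.mem_support_iff]
    have hs' : (univ.filter fun i : Fin n => ¬ m i = 0) = m.support := by
      ext i; simp [Finsupp.mem_support_iff]
    rw [hs, hs', mul_comm]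
  simp only [svGenCoeff, map_add, map_sum, map_mul, eval_X, Sum.elim_inl, map_one, hprod]

/-- **Coefficient vector = generator output**: the coefficient of the multilinear monomial `x^m` in
`Q^{SV'}_{n,k}(α, β, x)` is the generator coordinate `G^{SV'}_{n,k}(α, β)_m`
(`G^{SV'} = coeff_x(Q^{SV'})`, FSV Constructions 25/29). [cite: ForbesShpilkaVolk2018, Constructions 25 and 29] -/
theorem coeff_svPoly_eq_eval_svGenCoeff (n k : ℕ) (α : Fin k → F) (β : Fin k → Fin n → F)
    {m : Fin n →₀ ℕ} (hm : m ∈ multilinearMonomials n) :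
    coeff m (svPoly F n k α β) = eval (Sum.elim α fun p : Fin k × Fin n => β p.1 p.2) (svGenCoeff F n k m) := by
  rw [coeff_svPoly, if_pos hm, eval_svGenCoeff]

end Generator

/-! ## FSV Cor. 34: the shifted succinct SV generator hits sparse polynomials -/

section Sparse

/-- **Forbes–Shpilka–Volk 2018, Cor. 34 (NAMED FACT, generator form): the shifted succinct SV
generator hits sparse polynomials.** For every field `𝔽`, all `n, k` and every nonzero polynomial
`D` in the `N = 2ⁿ` coefficient variables `c_m` (`m` multilinear) with at most `2^k` monomials,
the composition `D ∘ G^{SV'}_{n,k}` — substitute the generator coordinate `svGenCoeff n k m` for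
`c_m` — is a nonzero polynomial in the seed variables. Printed: "The generator `G^{SV'}_{n, log s}`
from Construction 29 is a `poly(log s, n)`-`ΣΠΣ` succinct generator for the class of `s`-sparse
polynomials `F ∈ 𝔽[X_1, …, X_N]`" (generator = Def. 7 (3): `D ≠ 0 ⇒ D ∘ G ≢ 0`); here `s ≤ 2^k`,
i.e. `k ≥ ⌈log s⌉`, which the printed statement implies (more seed blocks only help: set the extra
`y_j = 0`). Proof in print, NOT formalised: a nonzero `s`-sparse polynomial shifted by `𝟙` has a
monomial of support `≤ log s` (Lemma 32, via Oliveira's sparsity Lemma 33), and fixing `z` to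
indicator vectors plants free `y`'s on any `≤ k` coordinates (Lemma 28), so that monomial survives
(Lemma 31). [cite: ForbesShpilkaVolk2018, Cor. 34] -/
def ForbesShpilkaVolk2018_svGeneratorHitsSparse (F : Type*) [Field F] : Prop :=
  ∀ (n k : ℕ) (D : MvPolynomial (multilinearMonomials n) F), D ≠ 0 → D.support.card ≤ 2 ^ k →
    bind₁ (fun m : multilinearMonomials n => svGenCoeff F n k (m : Fin n →₀ ℕ)) D ≠ 0

variable {F : Type*} [Field F]

/-- Composition with the generator, evaluated at a seed, is `D` evaluated at the coefficient vector
of `Q^{SV'}_{n,k}(α, β, x)`. [cite: ForbesShpilkaVolk2018, Def. 7] -/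
theorem eval_bind₁_svGenCoeff (n k : ℕ) (D : MvPolynomial (multilinearMonomials n) F)
    (α : Fin k → F) (β : Fin k → Fin n → F) :
    eval (Sum.elim α fun p : Fin k × Fin n => β p.1 p.2)
        (bind₁ (fun m : multilinearMonomials n => svGenCoeff F n k (m : Fin n →₀ ℕ)) D) =
      eval (fun m : multilinearMonomials n => coeff (m : Fin n →₀ ℕ) (svPoly F n k α β)) D := by
  have hfun : (fun m : multilinearMonomials n =>
      eval₂Hom (RingHom.id F) (Sum.elim α fun p : Fin k × Fin n => β p.1 p.2)
        (svGenCoeff F n k (m : Fin n →₀ ℕ))) =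
      fun m : multilinearMonomials n => coeff (m : Fin n →₀ ℕ) (svPoly F n k α β) := by
    funext m
    exact (coeff_svPoly_eq_eval_svGenCoeff n k α β m.2).symm
  rw [eval, eval₂Hom_bind₁, hfun]
  rfl

/-- **Succinct hitting set for sparse polynomials (FSV Thm. 9, bullet "sparse polynomials"; from
Cor. 34 over an infinite field).** If `D ≠ 0` has at most `2^k` monomials then some seed `(α, β)`
makes `D` non-vanish at the coefficient vector of the explicit multilinear `ΣΠΣ` polynomial
`svPoly n k α β` — i.e. `{svPoly n k α β}` is a succinct hitting set for `2^k`-sparse polynomials in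
the sense of `IsSuccinctHittingSet` of `Literature.Barriers.ValiantsHypothesis` (print, remark after
Def. 7: over large enough fields a generator's image is a hitting set; here: a nonzero polynomial
over an infinite field has a non-root, Mathlib `MvPolynomial.funext`). [cite: ForbesShpilkaVolk2018, Thm. 9 and Cor. 34] -/
theorem ForbesShpilkaVolk2018_svGeneratorHitsSparse.exists_svPoly [Infinite F]
    (h : ForbesShpilkaVolk2018_svGeneratorHitsSparse F) (n k : ℕ)
    (D : MvPolynomial (multilinearMonomials n) F) (hD : D ≠ 0) (hs : D.support.card ≤ 2 ^ k) :
    ∃ (α : Fin k → F) (β : Fin k → Fin n → F),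
      eval (fun m : multilinearMonomials n => coeff (m : Fin n →₀ ℕ) (svPoly F n k α β)) D ≠ 0 := by
  have hne := h n k D hD hs
  obtain ⟨x, hx⟩ : ∃ x : Fin k ⊕ (Fin k × Fin n) → F,
      eval x (bind₁ (fun m : multilinearMonomials n => svGenCoeff F n k (m : Fin n →₀ ℕ)) D) ≠ 0 := by
    by_contra hcon
    push Not at hcon
    exact hne (MvPolynomial.funext fun x => by rw [hcon x, map_zero])
  refine ⟨fun j => x (Sum.inl j), fun j i => x (Sum.inr (j, i)), ?_⟩
  have hx' : x = Sum.elim (fun j => x (Sum.inl j)) (fun p : Fin k × Fin n => x (Sum.inr (p.1, p.2))) := by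
    funext v; cases v <;> rfl
  rw [← eval_bind₁_svGenCoeff]
  rwa [← hx']

end Sparse

end Literature.Computability.AlgebraicComplexity

end
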